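import Literature.AlgebraicGeometry.ShimuraVarieties.KudlaRapoport2013.Sec2Defs
import HarnessLib

/-!
# Kudla–Rapoport, *Special cycles on unitary Shimura varieties II: global theory* — Part II, §5 «Uniformization of the
# supersingular locus» and §6 «Special cycles in the supersingular locus» (arXiv 0912.3758 **v2** = Crelle 697, v2 pp. 22–29)
# — SECTION CARPET (statements only, typed ON `𝔽̄_p`-POINTS; no proofs)

[KudlaRapoport2013] = S. Kudla, M. Rapoport, *Special cycles on unitary Shimura varieties II: global theory*, J. reine angew. Math.
**697** (2014) 91–157 = arXiv:0912.3758.  SOURCE OF RECORD: arXiv **v2** (version of record; squad kit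
`T/KR/TKR-t01/g0/KR2013-arxiv-v2-pages.TKR-t01-g0.txt`, «p. N» = arXiv v2 page), symbols re-read on the held v1 TeX
`paper:arxiv-0912.3758` chunks p0017–p0021.  NUMBERING = v2 = print.  v1 ↔ v2 for §§5–6: v2 **Lemma 5.1** (non-emptiness of the
supersingular locus of each `M(n−r,r)^{V♯}(𝔽)`, with proof) replaces v1's Remark 5.1 («we can choose a base point giving rise to each
`V♯` for which `M(n−r,r)^{V♯}(𝔽)` is non-empty»); Rem. 5.2, Prop. 5.3, Lem. 5.4, Thm. 5.5, Rem. 5.6, Cor. 5.7, Lem. 6.1, Def. 6.2, Prop.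
6.3, Rem. 6.4 carry the same numbers in v1 and v2; displays (5.1)–(5.9), (6.1)–(6.9) are v2's.

## What this file is (squad TKR, seat TKR-t01, deal sheet `SPLIT-TKR.v1` row t01, second block)

The carpet of §§5–6 over the §2 vocabulary ★ `KudlaRapoport2013.Sec2Defs` (`Sec2Core k`, `Sec2Data C`, the REAL objects `Obj` /
`M0Obj` / `MObj` / `ZObj` over an `O_k`-scheme, `HomOK`, `RelevantSharp`, `IsSupersingular`, `hermForm`, `pairLabel`, …).  §§5–6
are statements about FORMAL ALGEBRAIC STACKS over `W = W(𝔽̄_p)` — the Rapoport–Zink functor `N` on `Nilp_W`, the formal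
completion `\hat M(n−r,r)^{ss}` along the supersingular locus, the uniformization morphism `Θ` (5.6), the formal special cycles
`\hat Z(T)` (6.1) — none of which has vocabulary in Mathlib or the tree (no formal schemes, no Rapoport–Zink spaces, no
quasi-isogenies of `p`-divisible groups with `O_k`-action and polarization).  Following the sibling carpets' discipline
(`RapoportSmithlingZhang2020.Sec3IntegralModels.Lemma34_complexFibre`: a statement about a stack is typed ON POINTS over a
field when that is the honest shadow), every result here is typed ON `𝔽`-POINTS, `𝔽 = 𝔽̄_p` (`S = Spec 𝔽 ∈ Nilp_W`): the
objects of `M(n−r,r)(𝔽)`, `M₀(𝔽)`, `M(𝔽)`, `Z(T)(𝔽)` are the REAL §2 objects over the structure map `f_𝔽 : Spec 𝔽 → Spec O_k`;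
`N(𝔽)`, `N₀(𝔽)`, `I^V(ℚ)`, `I^{V₀}(ℚ)`, `G^V(𝔸_f^p)^0/K^p`, `G^{V₀}(𝔸_f^p)^0/K₀^p`, the maps `Θ(𝔽)`, `Θ₀(𝔽)`, the actions
`α_p(γ)`, `α^p(γ)`, the hermitian space `Ṽ' = Hom⁰_{O_k}(E°, A°)` with `h'` (6.3)–(6.4), local isometry at `ℓ`, the
incidence conditions (b), (c) of Prop. 6.3 and the collection `x = φ^{-1} ∘ x° ∘ φ₀` are ⟨CARRIER⟩s of ONE datum
`structure Sec5Data D p 𝔽` (each quoting its print; TOTAL with inhabited codomains; nothing asserted), and the FORMAL-STACK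
sentences themselves (Prop. 5.3's functor morphism with (i)–(iii), the isomorphisms of formal algebraic stacks of Thm. 5.5 /
Cor. 5.7 / Prop. 6.3, «`N₀ = Spf W`») are recorded as `Prop` TOKENS in `Stack5Sentences`, conjoined to the ON-POINTS typing and
marked DELIBERATELY WEAKER than print.  Every numbered Lemma / Proposition / Theorem / Corollary / Definition of §§5–6 is a
`def … (N : Sec5Data D p 𝔽) : Prop` PREDICATE on the consumer's datum; `∀ N, …` is never claimed.  NOTHING IS ASSERTED, nothing
proved; no instance, no notation.

Standing hypotheses of §5 (p. 22–23) carried by the datum: «Let `p` be a prime inert in `k`», «`𝔽 = 𝔽̄_p`», «For the rest of this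
section, we will discuss only the case `p ≠ 2`» (§6 p. 27: «We continue to treat the case `p ≠ 2`»), and the fixed trivialization
(5.1) of the prime-to-`p` roots of unity (implicit in the carriers, Remark 5.2).

## INDEX — every item of §§5–6 (v2 pp. 22–29) ↦ declaration («token» = recorded formal-stack sentence of `Stack5Sentences`)

§5 (pp. 22–27): the RZ functor `N = N(n−r,r)` on `Nilp_W`, framing object `(𝕏, ι, λ_𝕏) = (X(A°), ι°, λ_{X(A°)})`, (5.1) ↦ ⟨CARRIER⟩
`Sec5Data.NPts` (= `N(𝔽)`), base points = supersingular `ξ° ∈ M(n−r,r)(𝔽)` (REAL `C.Obj f_𝔽` + ⟨CARRIER⟩ `IsSupersingular`); «there is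
a unique relevant `V` (resp. `V♯`, `p ≠ 2`) with `T^p(A°)^0 ≅ V ⊗ 𝔸_f^p`» = the label ★ `Sec2Data.labelSharp`; **Lem. 5.1** ↦ `Lemma51`;
(5.4)–(5.6) `η°`, `K^p`, `Θ` ↦ ⟨CARRIER⟩ `GModK`, `thetaPts`; **Rem. 5.2** (canonical trivialization at all geometric points; `η̃°_S`
an isometry; functoriality) — recorded in docstrings, not typed; **Prop. 5.3** ↦ `Prop53` (token + ON POINTS: `Θ(ξ, gK^p)` is a
supersingular object with label `V♯`); `I(ℚ) = I^V(ℚ)`, `α_p`, `α^p` ↦ ⟨CARRIER⟩ `IQ`, `IQmul`, `actN`, `actG`; **Lem. 5.4** ↦ `Lemma54`;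
**Thm. 5.5** ↦ `Thm55` (token + ON POINTS: `Θ(𝔽)` induces a bijection `I^V(ℚ)∖(N(𝔽) × G^V(𝔸_f^p)^0/K^p) ≅ M(n−r,r)^{V♯,ss}(𝔽)/≅`);
**Rem. 5.6** (disjoint sum over a strict similarity class) — not typed (remark); «`N₀ = Spf W` is trivial (canonical lifting)» ↦
`N0_trivial` (token + ON POINTS: `N₀(𝔽)` is a singleton); (5.8)–(5.9) ↦ ⟨CARRIER⟩ `label0` (`V₀ = V(ξ₀)`), `InPart` (the `(V♯, V₀)`-part relative to a base pair); **Cor. 5.7** ↦ `Cor57`.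
§6 (pp. 27–29): notation, (6.1) `\hat Z^{(V♯,V₀),ss}(T)` (token level); `Ṽ = Hom_k(V₀, V)` = ★ `Sec2Data.pairLabel` of the base pair,
(6.2); `Ṽ' = Hom⁰_{O_k}(E°, A°)` with `h'` (6.3)–(6.4) ↦ ⟨CARRIER⟩ `tildeVprime`, `tildeVprimeEmb`; (6.5)–(6.6) `x ↦ x`, `𝕍` — inside
the carriers of Prop. 6.3; **Lem. 6.1** ↦ `Lemma61_a`, `Lemma61_b` (REAL ★ `HermSpace.rationalPoints` for `U(Ṽ')(ℚ)`, REAL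
`k^1 = ker Nm_{k/ℚ}`); **Def. 6.2** `Z(x) ⊂ N × N₀` ↦ ⟨CARRIER⟩ `InZx` with `Def62_Zx` (its `𝔽`-points as a set); **Prop. 6.3** ↦ `IncPts`
(the incidence set `Inc_p(T; V♯, V₀)(𝔽)`, REAL conditions (a) over ⟨CARRIER⟩ (b), (c)), `Prop63` (token + ON POINTS); **Rem. 6.4** ↦
`Rem64` ((6.9) on points + `Ṽ' ≅ V_T` REAL: an isometry `k^n ≅ Ṽ'` with Gram matrix `T` sending `e_i ↦ x_i`).

READINGS: R1 «ON POINTS» as above; R2 isomorphism of `𝔽`-points of `M(n−r,r)`, `M₀`, `M` = ★ `NaiveObj.Iso`, `M0Obj.Iso` (REAL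
isomorphism of the abelian schemes commuting with the actions, ⟨CARRIER⟩ polarization pull-back), of `Z(T)` = ★ `ZObj.Iso` (the same,
carrying `x` to `x'`); R3 «`V♯`-part» of the supersingular locus = objects whose ★ `labelSharp` is isomorphic in `R^♯` to `V♯`
(★ `RelevantSharp.Iso`); R4 group isomorphisms `I^V(ℚ) ≅ U(Ṽ')(ℚ)`, `I^{V₀}(ℚ) ≅ k^1` = bijections compatible with the ⟨CARRIER⟩
multiplications `IQmul`, `IQ0mul`; R5 «isomorphic at all finite places `ℓ ≠ p`» = ⟨CARRIER⟩ `LocIsometric · · ℓ`; R6 `V_T = k^n` with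
the form `(v, w) = Σ v_i T_{ij} w_j^σ` (★ `HermSpace.form` is linear in the first variable, as is `h'`).

## NOT here
§§7–10 (Part III, Eisenstein series: squad file `Sec7to10EisensteinSide`); the construction of `Θ` (Prop. 5.3's proof, [RZ] §6); `p = 2`
(«slight modifications», p. 23); DM/formal stacks; proofs.

## References
* [KudlaRapoport2013] S. Kudla, M. Rapoport, *Special cycles on unitary Shimura varieties II: global theory*, J. reine angew. Math. 697
  (2014) 91–157 = arXiv:0912.3758v2, §5 pp. 22–27 (Lem. 5.1 p. 23, Rem. 5.2 p. 24, Prop. 5.3 p. 25, Lem. 5.4 p. 25, Thm. 5.5 p. 26,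
  Rem. 5.6 p. 26, Cor. 5.7 p. 27), §6 pp. 27–29 (Lem. 6.1 p. 28, Def. 6.2 p. 28, Prop. 6.3 pp. 28–29, Rem. 6.4 p. 29).
* [RapoportZink1996] M. Rapoport, Th. Zink, *Period spaces for p-divisible groups*, Ann. Math. Studies 141 (1996), Ch. 6, Thm. 6.30 — the
  uniformization theorem Thm. 5.5 instantiates (cited by KR as [52]; provenance only, nothing of it is typed here).
-/

noncomputable section

open NumberField CategoryTheory CategoryTheory.Limits AlgebraicGeometry MonoidalCategory CartesianMonoidalCategory
open scoped MonObj
open Literature.AlgebraicGeometry.AbelianSchemes (AbelianSchemeOver)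
open Literature.NumberTheory.Automorphic.Liu2021.AppendixC (HermSpace conj)
open Literature.AlgebraicGeometry.ShimuraVarieties.KudlaRapoport2013.Sec2Defs
open Literature.AlgebraicGeometry.ShimuraVarieties.KudlaRapoport2013.Sec2Defs.Sec2Core (HomOK)

namespace Literature.AlgebraicGeometry.ShimuraVarieties.KudlaRapoport2013.Sec5Sec6SupersingularLocus

variable {k : Type} [Field k] [NumberField k] [IsTotallyComplex k] [Algebra.IsQuadraticExtension ℚ k]

/-! ## The recorded formal-stack sentences of §§5–6 (tokens) -/

/-- **RECORDED FORMAL-STACK SENTENCES of §§5–6** (no vocabulary for formal schemes / Rapoport–Zink functors / formal completions of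
stacks in Mathlib or the tree; each field is the printed sentence kept as a `Prop` TOKEN the consumer instantiates — placeholders,
conjoined below to the ON-POINTS typing and never mixed with REAL clauses otherwise): (1) Prop. 5.3 «there is a morphism of functors
on `Nilp_W`, `Θ : N × G(𝔸_f^p)^0/K^p → M(n−r,r)` (5.6): for each `ξ ∈ N(S)` and coset `gK^p` an object `Θ(ξ, gK^p) = (A, ι, λ)` of
`M(n−r,r)(S)` and an `O_k`-linear quasi-isogeny `φ : A → Ã°_S` uniquely characterized by (i) `λ` agrees with `φ^∨ ∘ λ̃°_S ∘ φ`, (ii)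
`η = η̃°_S ∘ φ_*` satisfies `η(T^p(A)) = g · (L ⊗ Ẑ^p)`, (iii) the `p`-divisible group of `(A, ι)` is identified with `(X, ι)` so that
`φ` induces `ρ_X`; functorial in `S`»; (2) Thm. 5.5 «`Θ` induces an isomorphism `Θ : [I^V(ℚ)∖(N × G^V(𝔸_f^p)^0/K^p)] ≅ \\hat M(n−r,r)^{V♯,ss}`
of formal algebraic stacks over `W`»; (3) «`N₀ = N(1,0)` is trivial, i.e., is equal to `Spf W` (canonical lifting)» (p. 26); (4) Cor. 5.7
«`\\hat M^{(V♯,V₀),ss} ≅ (I^V(ℚ) × I^{V₀}(ℚ))∖(N × N₀ × G^V(𝔸_f^p)^0/K^{V♯,p} × G^{V₀}(𝔸_f^p)^0/K₀^p)` as formal stacks over `Spf W`»;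
(5) Prop. 6.3 «`Inc_p(T; V♯, V₀)` is (the functor of points of) the formal scheme `∐_{(gK, g₀K₀)} ∐_{x°} Z(x°)` and there is an
isomorphism of formal stacks over `W`, compatible with Cor. 5.7, `(I^V(ℚ) × I^{V₀}(ℚ))∖Inc_p(T; V♯, V₀) ≅ \\hat Z^{(V♯,V₀),ss}(T)`».
[cite: KudlaRapoport2013, §5 Proposition 5.3, Theorem 5.5, Corollary 5.7 (arXiv v2 pp. 25–27); §6 Proposition 6.3 (arXiv v2 pp. 28–29)] -/
structure Stack5Sentences : Type where
  /-- ⟨TOKEN⟩ (1) Prop. 5.3: the functor morphism `Θ` on `Nilp_W` with (i)–(iii), functorial in `S`. -/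
  prop53 : Prop
  /-- ⟨TOKEN⟩ (2) Thm. 5.5: `Θ` induces an isomorphism of formal algebraic stacks over `W` onto `\hat M(n−r,r)^{V♯,ss}`, for each `V♯`. -/
  thm55 : Prop
  /-- ⟨TOKEN⟩ (3) «`N₀ = Spf W`» (p. 26). -/
  n0Trivial : Prop
  /-- ⟨TOKEN⟩ (4) Cor. 5.7: the product uniformization of `\hat M^{(V♯,V₀),ss}` as formal stacks over `Spf W`. -/
  cor57 : Prop
  /-- ⟨TOKEN⟩ (5) Prop. 6.3: `Inc_p` is a formal scheme and `(I^V(ℚ) × I^{V₀}(ℚ))∖Inc_p(T;V♯,V₀) ≅ \hat Z^{(V♯,V₀),ss}(T)`. -/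
  prop63 : Prop

/-! ## The datum of §§5–6 on `𝔽`-points -/

/-- **The datum of [KudlaRapoport2013] §§5–6 on `𝔽 = 𝔽̄_p`-points**, over the §2 datum `C : Sec2Core k`, `D : Sec2Data C`.  REAL:
the standing hypotheses «`p` a prime inert in `k`», «`p ≠ 2`» (pp. 22–23), «`𝔽 = 𝔽̄_p`» (algebraically closed of characteristic `p`),
the structure map `f_𝔽 : Spec 𝔽 → Spec O_k` (through `O_k/pO_k = 𝔽_{p²} ⊂ 𝔽`).  ⟨CARRIER⟩ (posited types / functions standing for
printed objects without tree vocabulary; TOTAL with inhabited codomains chosen by the consumer; nothing asserted): `N(𝔽)`, `N₀(𝔽)`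
(iso-classes of `(X, ι, λ_X, ρ_X)` over `𝔽`, p. 22), the groups `I^V(ℚ)` / `I^{V₀}(ℚ)` of quasi-isogenies preserving the
polarization of a base point (p. 25) with their multiplications and their actions `α_p` on `N(𝔽)` and `α^p` on `G^V(𝔸_f^p)^0/K^p`
(p. 25), the coset spaces `G^V(𝔸_f^p)^0/K^p` (`K^p = Stab(L)`, (5.4)) and `G^{V₀}(𝔸_f^p)^0/K₀^p`, the maps `Θ(𝔽)` (5.6) and `Θ₀(𝔽)`
attached to a base point (junk unless the base point is supersingular with the indicated label), the hermitian space
`Ṽ' = Hom⁰_{O_k}(E°, A°)` with `h'(x, y) = (λ₀°)^{-1} ∘ y^∨ ∘ λ° ∘ x` ((6.3)–(6.4); REAL codomain ★ `HermSpace ℚ k`) with the inclusion of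
`Hom_{O_k}(E°, A°)`, local isometry of hermitian spaces at a prime `ℓ`, and the incidence data of Prop. 6.3: condition (b)
«`g^{-1} ∘ x° ∘ g₀ ∈ Hom_{O_k ⊗ Ẑ^p}(T^p(E°), T^p(A°))^m`», condition (c) «`(ξ, ξ₀) ∈ Z(x°)(𝔽)`» (Def. 6.2: «the quasi-homomorphism
`ρ_X^{-1} ∘ x ∘ ρ_Y : Y^m → X` extends to a homomorphism», through `x ↦ x ∈ 𝕍 = Hom_{O_k ⊗ ℤ_p}(𝕏₀, 𝕏) ⊗ ℚ` (6.6)), and the collection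
`x = φ^{-1} ∘ x° ∘ φ₀ ∈ Hom_{O_k}(E, A)^m` of the proof of Prop. 6.3 (p. 29). [cite: KudlaRapoport2013, §5–§6 (arXiv v2 pp. 22–29)] -/
structure Sec5Data {C : Sec2Core k} (D : C.Sec2Data) (p : ℕ) (𝔽 : Type) [Field 𝔽] : Type 2 where
  /-- «Let `p` be a prime inert in `k`» (p. 22; ★ `IsInertPrime`, which includes primality). -/
  inert : IsInertPrime k p
  /-- «we will discuss only the case `p ≠ 2`» (p. 23; §6 p. 27). -/
  p_ne_two : p ≠ 2
  /-- «`𝔽 = 𝔽̄_p`»: algebraically closed … -/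
  isAlgClosed : IsAlgClosed 𝔽
  /-- … of characteristic `p`. -/
  charP : CharP 𝔽 p
  /-- the structure map `f_𝔽 : Spec 𝔽 → Spec O_k` (REAL), through which `M(n−r,r)(𝔽)` etc. are the §2 objects over `f_𝔽`. -/
  f𝔽 : Spec (.of 𝔽) ⟶ Spec (.of (𝓞 k))
  /-- ⟨CARRIER⟩ `N(𝔽) = N(n−r,r)(𝔽)`: isomorphism classes of `(X, ι, λ_X, ρ_X)` — `X` a `p`-divisible group over `𝔽` with `O_k`-action of
  type `(n−r, r)`, `p`-principal polarization `λ_X`, and an `O_k`-linear quasi-isogeny `ρ_X : X → 𝕏` of height `0` respecting the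
  polarizations up to `ℤ_p^×` (p. 22). -/
  NPts : Type
  /-- ⟨CARRIER⟩ `N₀(𝔽) = N(1,0)(𝔽)` (p. 26). -/
  N0Pts : Type
  /-- ⟨CARRIER⟩ `I^V(ℚ)`: «the group of quasi-isogenies in `End⁰_{O_k}(A°)` that preserve the polarization `λ°`» of the base point
  `ξ° = (A°, ι°, λ°)` (p. 25), as a type … -/
  IQ : C.Obj f𝔽 → Type
  /-- ⟨CARRIER⟩ … with its group multiplication (composition of quasi-isogenies). -/
  IQmul : ∀ {ξ : C.Obj f𝔽}, IQ ξ → IQ ξ → IQ ξ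
  /-- ⟨CARRIER⟩ `I^{V₀}(ℚ)` for a base point `(E°, ι₀°, λ₀°) ∈ M₀(𝔽)` … -/
  IQ0 : C.M0Obj f𝔽 → Type
  /-- ⟨CARRIER⟩ … with its multiplication. -/
  IQ0mul : ∀ {e : C.M0Obj f𝔽}, IQ0 e → IQ0 e → IQ0 e
  /-- ⟨CARRIER⟩ `α_p(γ)`: «`γ ∈ I(ℚ)` induces a quasi-isogeny `α_p(γ)` of height `0` of `(𝕏, ι, λ_𝕏)` and hence acts on `N` by
  `ξ = (X, ι, λ_X, ρ_X) ↦ (X, ι, λ_X, α_p(γ) ∘ ρ_X)`» (p. 25), on `𝔽`-points. -/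
  actN : ∀ {ξ : C.Obj f𝔽}, IQ ξ → NPts → NPts
  /-- ⟨CARRIER⟩ the action of `I^{V₀}(ℚ)` on `N₀(𝔽)`. -/
  actN0 : ∀ {e : C.M0Obj f𝔽}, IQ0 e → N0Pts → N0Pts
  /-- ⟨CARRIER⟩ `G^V(𝔸_f^p)^0/K^p` for `V♯ = (V, [[L]])`, `K^p` «the stabilizer of `L` in `G(𝔸_f^p)`», `G^V(𝔸_f^p)^0 = {g ∣ ν(g) ∈ (Ẑ^p)^×}`
  ((5.4) p. 24). -/
  GModK : C.RelevantSharp → Type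
  /-- ⟨CARRIER⟩ `α^p(γ) = η^{p,o} ∘ γ_* ∘ (η^{p,o})^{-1} ∈ G(𝔸_f^p)` «of scale factor `1`» acting on `G^V(𝔸_f^p)^0/K^p` (p. 25). -/
  actG : ∀ {ξ : C.Obj f𝔽} (P : C.RelevantSharp), IQ ξ → GModK P → GModK P
  /-- ⟨CARRIER⟩ `G^{V₀}(𝔸_f^p)^0/K₀^p` for `M₀` (Cor. 5.7, p. 27; `V₀` the relevant space of `M₀`, `R_{(1,0)}(k)`). -/
  G0ModK0 : Type
  /-- ⟨CARRIER⟩ the action of `I^{V₀}(ℚ)` on `G^{V₀}(𝔸_f^p)^0/K₀^p`. -/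
  actG0 : ∀ {e : C.M0Obj f𝔽}, IQ0 e → G0ModK0 → G0ModK0
  /-- ⟨CARRIER⟩ **`Θ` on `𝔽`-points** (Prop. 5.3, (5.6)): for the base point `ξ°` (used with `ξ°` supersingular of label `V♯`) the object
  `Θ(ξ, gK^p) = (A, ι, λ) ∈ M(n−r,r)(𝔽)` (junk off such base points). -/
  thetaPts : ∀ (ξ : C.Obj f𝔽) (P : C.RelevantSharp), NPts → GModK P → C.Obj f𝔽
  /-- ⟨CARRIER⟩ `Θ₀` on `𝔽`-points for `M₀` and a base point `(E°, ι₀°, λ₀°)`. -/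
  theta0Pts : C.M0Obj f𝔽 → N0Pts → G0ModK0 → C.M0Obj f𝔽
  /-- ⟨CARRIER⟩ `V₀ = V(ξ₀) ∈ R_{(1,0)}(k)`, the relevant (positive definite, one-dimensional) hermitian space attached to a point
  `(E, ι₀, λ₀) ∈ M₀(𝔽)` (proof of Prop. 2.12, p. 12; the index `V₀` of the decomposition (5.8) `\hat M^{Ṽ♯,ss} = ∐_{(V♯,V₀)} \hat M^{(V♯,V₀),ss}`,
  «`(V♯, V₀)` runs over pairs in `R_{(n−r,r)}(k)^♯ × R_{(1,0)}(k)` with `Hom_k(V₀, V) ≅ Ṽ`», p. 27). -/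
  label0 : C.M0Obj f𝔽 → HermSpace ℚ k
  /-- ⟨CARRIER⟩ **`Ṽ' = Hom⁰_{O_k}(E°, A°)`** with hermitian form `h'(x, y) = (λ₀°)^{-1} ∘ y^∨ ∘ λ° ∘ x` ((6.3)–(6.4) p. 27) for a pair
  `(A°, ι°, λ°; E°, ι₀°, λ₀°) ∈ M(𝔽)` — REAL codomain ★ `HermSpace ℚ k` (junk off supersingular pairs, where `Hom⁰` may be `0`). -/
  tildeVprime : C.MObj f𝔽 → HermSpace ℚ k
  /-- ⟨CARRIER⟩ the inclusion `Hom_{O_k}(E°, A°) ⊂ Hom⁰_{O_k}(E°, A°) = Ṽ'(ℚ)` (p. 27). -/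
  tildeVprimeEmb : ∀ y : C.MObj f𝔽, HomOK y.pt₀.ι₀ y.pt.ιA → (tildeVprime y).V
  /-- ⟨CARRIER⟩ «the hermitian spaces `V`, `W` are isomorphic at the finite place `ℓ`» (Lem. 6.1 (a), p. 28): `V ⊗ ℚ_ℓ ≅ W ⊗ ℚ_ℓ` as
  hermitian spaces over `k ⊗ ℚ_ℓ`. -/
  LocIsometric : HermSpace ℚ k → HermSpace ℚ k → ℕ → Prop
  /-- ⟨CARRIER⟩ Prop. 6.3 (b): «`g^{-1} ∘ x° ∘ g₀ ∈ Hom_{O_k ⊗ Ẑ^p}(T^p(E°), T^p(A°))^m`», for `x = η° ∘ x° ∘ (η₀°)^{-1}` (6.5) (p. 28). -/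
  IsIntegralPair : ∀ {y : C.MObj f𝔽} (P : C.RelevantSharp) {m : ℕ}, GModK P → G0ModK0 → (Fin m → (tildeVprime y).V) → Prop
  /-- ⟨CARRIER⟩ Prop. 6.3 (c) / **Def. 6.2**: «`(ξ, ξ₀) ∈ Z(x°)(𝔽)`», `Z(x)(S)` being «the set of isomorphism classes of collections
  `(X, ι, λ_X, ρ_X; Y, ι, λ_Y, ρ_Y)` in `(N × N₀)(S)` such that the quasi-homomorphism `ρ_X^{-1} ∘ x ∘ ρ_Y : Y^m ×_S S̄ → X ×_S S̄` extends to
  a homomorphism from `Y^m` to `X`» (p. 28), with `x ∈ Hom_{O_k ⊗ ℤ_p}(𝕏₀, 𝕏)^m = 𝕍^m` induced by `x°` (6.6). -/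
  InZx : ∀ {y : C.MObj f𝔽} {m : ℕ}, (Fin m → (tildeVprime y).V) → NPts → N0Pts → Prop
  /-- ⟨CARRIER⟩ «the collection `x = φ^{-1} ∘ x° ∘ φ₀ ∈ Hom⁰_{O_k}(E, A)^m` actually lies in `Hom_{O_k}(E, A)^m`» (proof of Prop. 6.3, p. 29):
  the `m`-tuple of homomorphisms attached to an incidence tuple (junk off `Inc_p`). -/
  xOfInc : ∀ (y : C.MObj f𝔽) (P : C.RelevantSharp) {m : ℕ} (a : NPts) (a₀ : N0Pts) (g : GModK P) (g₀ : G0ModK0),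
    (Fin m → (tildeVprime y).V) → Fin m → HomOK (theta0Pts y.pt₀ a₀ g₀).ι₀ (thetaPts y.pt P a g).ιA
  /-- the recorded formal-stack sentences. -/
  stack : Stack5Sentences

namespace Sec5Data

variable {C : Sec2Core k} {D : C.Sec2Data} {p : ℕ} {𝔽 : Type} [Field 𝔽]
variable (N : Sec5Data D p 𝔽)

/-- A base point of the `V♯`-part of the supersingular locus: «a base point `ξ° = (A°, ι°, λ°)` lying in the supersingular locus of
`M(n−r,r)^{V♯}(𝔽)`» (p. 24; READING R3: label `≅ V♯` in `R^♯`). [cite: KudlaRapoport2013, §5 (arXiv v2 p. 24)] -/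
def IsBasePoint (ξ : C.Obj N.f𝔽) (P : C.RelevantSharp) : Prop :=
  C.IsSupersingular ξ.A ∧ (D.labelSharp N.f𝔽 ξ).Iso P

/-- A point of the `(V♯, V₀)`-part of the supersingular locus of `M = M(n−r,r) × M₀` relative to a base pair `y = (ξ°, e°)` ((5.8)–(5.9),
p. 26–27): both components supersingular, `(A, ι, λ)` of label `V♯`, and `(E, ι₀, λ₀)` with the same `V₀ = V(ξ₀)` as `e°` (⟨CARRIER⟩ `label0`,
up to isometry). [cite: KudlaRapoport2013, §5 (5.8)–(5.9) (arXiv v2 pp. 26–27)] -/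
def InPart (y z : C.MObj N.f𝔽) (P : C.RelevantSharp) : Prop :=
  N.IsBasePoint z.pt P ∧ C.IsSupersingular z.pt₀.E ∧ HermIso k (N.label0 z.pt₀) (N.label0 y.pt₀)

/-! ### §5 (pp. 22–27) -/

/-- **[KR2013, Lemma 5.1]** (p. 23): «For each `V♯ = (V, [[L]]) ∈ R_{(n−r,r)}(k)^♯`, the supersingular locus in `M(n−r,r)^{V♯}(𝔽)` is
non-empty.» — there is a supersingular object of `M(n−r,r)(𝔽)` whose label is `V♯` (READING R3). (v1: Remark 5.1, without proof;
proof in v2: `A = E^n` for a supersingular CM elliptic curve `E`, a modified polarization `λ₀ ∘ i(q)` and a prime-to-`p` isogeny.)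
[cite: KudlaRapoport2013, §5 Lemma 5.1 (arXiv v2 p. 23)] -/
def Lemma51 : Prop :=
  ∀ P : C.RelevantSharp, ∃ ξ : C.Obj N.f𝔽, N.IsBasePoint ξ P

/-- **[KR2013, Proposition 5.3]** (p. 25): the construction of `Θ(ξ, gK^p) = (A, ι, λ) ∈ M(n−r,r)(S)` with the quasi-isogeny `φ : A → Ã°_S`
«uniquely characterized by» (i) `λ = φ^∨ ∘ λ̃°_S ∘ φ`, (ii) `η(T^p(A)) = g · (L ⊗ Ẑ^p)` for `η = η̃°_S ∘ φ_*`, (iii) `(X(A), ι) ≅ (X, ι)` with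
`φ` inducing `ρ_X`; «functorial in `S`» (proof: [RZ] §6).  TYPED: the recorded ⟨TOKEN⟩ (1) (DELIBERATELY WEAKER than print: no
quasi-isogeny / RZ vocabulary) ∧ ON `𝔽`-POINTS the consequence used by Thm. 5.5: for a base point `ξ°` of the `V♯`-part, every
`Θ(ξ, gK^p)` is a supersingular object of label `V♯` (by (iii) `A` has supersingular `p`-divisible group; by (ii) its Tate module is
`V ⊗ 𝔸_f^p` with lattice in the genus of `L`). [cite: KudlaRapoport2013, §5 Proposition 5.3 (arXiv v2 p. 25)] -/
def Prop53 : Prop :=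
  N.stack.prop53 ∧
    ∀ (ξ : C.Obj N.f𝔽) (P : C.RelevantSharp), N.IsBasePoint ξ P →
      ∀ (a : N.NPts) (g : N.GModK P), N.IsBasePoint (N.thetaPts ξ P a g) P

/-- **[KR2013, Lemma 5.4]** (p. 25): «Any `γ ∈ I(ℚ)` induces an isomorphism `Θ(α_p(γ)ξ, α^p(γ)gK^p) ≅ Θ(ξ, gK^p)`, as points in
`M(n−r,r)(S)`. Conversely, any isomorphism `Θ(ξ, gK^p) ≅ Θ(ξ', g'K^p)` is induced by a unique `γ ∈ I(ℚ)`.» — ON `𝔽`-POINTS for a base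
point `ξ°` of the `V♯`-part (READING R2: ★ `NaiveObj.Iso`): (a) every `γ` induces an isomorphism; (b) conversely isomorphic values of `Θ`
come from `I(ℚ)`-related arguments; (c) «induced by a UNIQUE `γ`» READ as: the automorphisms of `Θ(ξ, gK^p)` in `M(n−r,r)(𝔽)` (REAL:
group-scheme automorphisms commuting with `ι` and pulling `λ` back to `λ`) correspond bijectively and multiplicatively to the stabilizer
of `(ξ, gK^p)` in `I(ℚ)` (DELIBERATELY WEAKER than print: the canonical map `γ ↦` induced isomorphism is posited only through its graph's
existence, the quasi-isogeny `φ` having no tree vocabulary). [cite: KudlaRapoport2013, §5 Lemma 5.4 (arXiv v2 p. 25)] -/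
def Lemma54 : Prop :=
  ∀ (ξ : C.Obj N.f𝔽) (P : C.RelevantSharp), N.IsBasePoint ξ P →
    (∀ (gm : N.IQ ξ) (a : N.NPts) (g : N.GModK P),
        (N.thetaPts ξ P (N.actN gm a) (N.actG P gm g)).toNaiveObj.Iso (N.thetaPts ξ P a g).toNaiveObj) ∧
    (∀ (a a' : N.NPts) (g g' : N.GModK P),
      (N.thetaPts ξ P a g).toNaiveObj.Iso (N.thetaPts ξ P a' g').toNaiveObj →
        ∃ gm : N.IQ ξ, a = N.actN gm a' ∧ g = N.actG P gm g') ∧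
    ∀ (a : N.NPts) (g : N.GModK P),
      ∃ e : {gm : N.IQ ξ // N.actN gm a = a ∧ N.actG P gm g = g} ≃
          {u : (N.thetaPts ξ P a g).A.X ≅ (N.thetaPts ξ P a g).A.X //
            IsMonHom u.hom ∧ (∀ b : 𝓞 k, u.hom ≫ (N.thetaPts ξ P a g).ιA.i b = (N.thetaPts ξ P a g).ιA.i b ≫ u.hom) ∧
              C.PolPullback u (N.thetaPts ξ P a g).pol (N.thetaPts ξ P a g).pol},
        ∀ gm gm' : {gm : N.IQ ξ // N.actN gm a = a ∧ N.actG P gm g = g},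
          ∀ h : N.actN (N.IQmul gm.1 gm'.1) a = a ∧ N.actG P (N.IQmul gm.1 gm'.1) g = g,
            (e ⟨N.IQmul gm.1 gm'.1, h⟩).1 = (e gm).1 ≪≫ (e gm').1

/-- **[KR2013, Theorem 5.5]** (p. 26): «Let `\hat M(n−r,r)^{ss}` denote the formal completion of `M(n−r,r) ×_{Spec O_k} Spec W(𝔽)` along its
supersingular locus. For a relevant space `V♯ = (V, [[L]])` in `R_{(n−r,r)}(k)^♯`, let `\hat M(n−r,r)^{V♯,ss}` be the open and closed sublocus
where the rational Tate module `T^p(A)^0` is isomorphic to `V ⊗ 𝔸_f^p` and the type of the hermitian lattice `T₂(A)` coincides with the type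
of the `G₁^V`-genus `[[L]]`. Then the map `Θ` induces an isomorphism `Θ : [I^V(ℚ)∖(N × G^V(𝔸_f^p)^0/K^p)] ≅ \hat M(n−r,r)^{V♯,ss}` of formal
algebraic stacks over `W`, where `K^p` is the stabilizer of `L` in `G^V(𝔸_f^p)`.»  TYPED: the recorded ⟨TOKEN⟩ (2) (DELIBERATELY WEAKER
than print) ∧ ON `𝔽`-POINTS: for a base point `ξ°` of the `V♯`-part, `Θ(𝔽)` is SURJECTIVE onto the supersingular objects of label `V♯`
up to isomorphism (injectivity modulo `I^V(ℚ)` being `Lemma54`). [cite: KudlaRapoport2013, §5 Theorem 5.5 (arXiv v2 p. 26)] -/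
def Thm55 : Prop :=
  N.stack.thm55 ∧
    ∀ (ξ : C.Obj N.f𝔽) (P : C.RelevantSharp), N.IsBasePoint ξ P →
      ∀ x : C.Obj N.f𝔽, N.IsBasePoint x P → ∃ (a : N.NPts) (g : N.GModK P), x.toNaiveObj.Iso (N.thetaPts ξ P a g).toNaiveObj

/-- **«In this case the formal scheme `N₀ = N(1,0)` is trivial, i.e., is equal to `Spf W` (canonical lifting)»** (p. 26): the recorded
⟨TOKEN⟩ (3) ∧ ON `𝔽`-POINTS: `N₀(𝔽)` is a single point. [cite: KudlaRapoport2013, §5 after Remark 5.6 (arXiv v2 p. 26)] -/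
def N0_trivial : Prop :=
  N.stack.n0Trivial ∧ Nonempty (Unique N.N0Pts)

/-- **[KR2013, Corollary 5.7]** (p. 27), with (5.8)–(5.9): «For a pair `(V♯, V₀)`, with `(M(n−r,r)^{V♯} × M₀^{V₀})^{ss}(𝔽)` non-empty, there is
an isomorphism of formal stacks over `Spf W`, `\hat M^{(V♯,V₀),ss} ≅ (I^V(ℚ) × I^{V₀}(ℚ))∖(N × N₀ × G^V(𝔸_f^p)^0/K^{V♯,p} × G^{V₀}(𝔸_f^p)^0/K₀^p)`.»
TYPED: the recorded ⟨TOKEN⟩ (4) ∧ ON `𝔽`-POINTS for a supersingular base pair `(ξ°, e°)` with `ξ°` of the `V♯`-part: every `𝔽`-point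
`(A, ι, λ; E, ι₀, λ₀)` of `M` in the `(V♯, V₀)`-part of `(ξ°, e°)` (`InPart`: `A`, `E` supersingular, `(A, ι, λ)` of label `V♯`, `(E, ι₀, λ₀)` with
the same `V₀ = V(ξ₀)` as `e°`) is isomorphic to `(Θ(ξ, gK^p), Θ₀(ξ₀, g₀K₀^p))`, and two such pairs are isomorphic iff they are related by
`I^V(ℚ) × I^{V₀}(ℚ)` (existence of the relating pair; no uniqueness is printed here).
[cite: KudlaRapoport2013, §5 Corollary 5.7 (arXiv v2 p. 27)] -/
def Cor57 : Prop :=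
  N.stack.cor57 ∧
    ∀ (y : C.MObj N.f𝔽) (P : C.RelevantSharp), N.IsBasePoint y.pt P → C.IsSupersingular y.pt₀.E →
      (∀ z : C.MObj N.f𝔽, N.InPart y z P →
          ∃ (a : N.NPts) (g : N.GModK P) (a₀ : N.N0Pts) (g₀ : N.G0ModK0),
            z.pt.toNaiveObj.Iso (N.thetaPts y.pt P a g).toNaiveObj ∧ z.pt₀.Iso (N.theta0Pts y.pt₀ a₀ g₀)) ∧
      ∀ (a a' : N.NPts) (g g' : N.GModK P) (a₀ a₀' : N.N0Pts) (g₀ g₀' : N.G0ModK0),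
        ((N.thetaPts y.pt P a g).toNaiveObj.Iso (N.thetaPts y.pt P a' g').toNaiveObj ∧
            (N.theta0Pts y.pt₀ a₀ g₀).Iso (N.theta0Pts y.pt₀ a₀' g₀')) ↔
          ∃ (gm : N.IQ y.pt) (gm₀ : N.IQ0 y.pt₀),
            a = N.actN gm a' ∧ g = N.actG P gm g' ∧ a₀ = N.actN0 gm₀ a₀' ∧ g₀ = N.actG0 gm₀ g₀'

/-! ### §6 (pp. 27–29) -/

/-- **[KR2013, Lemma 6.1 (a)]** (p. 28), for a supersingular base pair `(A°, ι°, λ°; E°, ι₀°, λ₀°) ∈ M(𝔽)`, `Ṽ = Hom_k(V₀, V)` (★ `pairLabel`),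
`Ṽ' = Hom⁰_{O_k}(E°, A°)` (⟨CARRIER⟩ `tildeVprime`): «The hermitian spaces `Ṽ` and `Ṽ'` are isomorphic at all finite places `ℓ ≠ p`. At
the archimedian place `Ṽ` has signature `(n−r, r)` and Hasse invariant `(−1)^r`, whereas `Ṽ'` has signature `(n, 0)` and Hasse
invariant `1`.» (READING R5; the Hasse invariants at `∞` are the ones determined by the signatures and are not typed separately;
`dim Ṽ' = n`.) [cite: KudlaRapoport2013, §6 Lemma 6.1 (a) (arXiv v2 p. 28)] -/
def Lemma61_a : Prop :=
  ∀ y : C.MObj N.f𝔽, C.IsSupersingular y.pt.A → C.IsSupersingular y.pt₀.E →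
    (∀ ℓ : ℕ, ℓ.Prime → ℓ ≠ p → N.LocIsometric (D.pairLabel N.f𝔽 y) (N.tildeVprime y) ℓ) ∧
      (D.pairLabel N.f𝔽 y).sig (algebraMap ℚ ℝ) = (C.n - C.r, C.r) ∧
        (N.tildeVprime y).n = C.n ∧ (N.tildeVprime y).sig (algebraMap ℚ ℝ) = (C.n, 0)

/-- **[KR2013, Lemma 6.1 (b)]** (p. 28): «`I^V(ℚ) ≅ U(Ṽ')(ℚ)`, and `I^{V₀}(ℚ) ≅ k^1 = ker(Nm_{k/ℚ})`.» — READING R4: bijections compatible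
with multiplication onto the REAL groups ★ `HermSpace.rationalPoints (Ṽ')` (`U(Ṽ')(ℚ)`) and `{x ∈ k ∣ Nm_{k/ℚ}(x) = 1}`.
[cite: KudlaRapoport2013, §6 Lemma 6.1 (b) (arXiv v2 p. 28)] -/
def Lemma61_b : Prop :=
  ∀ y : C.MObj N.f𝔽, C.IsSupersingular y.pt.A → C.IsSupersingular y.pt₀.E →
    (∃ e : N.IQ y.pt ≃ (N.tildeVprime y).rationalPoints, ∀ gm gm' : N.IQ y.pt, e (N.IQmul gm gm') = e gm * e gm') ∧
    (∃ e₀ : N.IQ0 y.pt₀ ≃ {x : k // Algebra.norm ℚ x = 1},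
      ∀ gm gm' : N.IQ0 y.pt₀, (e₀ (N.IQ0mul gm gm')).1 = (e₀ gm).1 * (e₀ gm').1)

/-- **[KR2013, Definition 6.2] on `𝔽`-points** (p. 28): «For a collection `x ∈ Hom_{O_k ⊗ ℤ_p}(𝕏₀, 𝕏)^m`, let `Z(x)` be the subfunctor of
`N × N₀`, where `Z(x)(S)` is the set of isomorphism classes of collections `(X, ι, λ_X, ρ_X; Y, ι, λ_Y, ρ_Y)` in `(N × N₀)(S)` such that the
quasi-homomorphism `ρ_X^{-1} ∘ x ∘ ρ_Y : Y^m ×_S S̄ → X ×_S S̄` extends to a homomorphism from `Y^m` to `X`.» — the subset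
`Z(x)(𝔽) ⊂ N(𝔽) × N₀(𝔽)` cut out by the ⟨CARRIER⟩ `InZx`, for `x` induced by `x° ∈ Ṽ'(ℚ)^m` (6.6). [cite: KudlaRapoport2013, §6 Definition 6.2 (arXiv v2 p. 28)] -/
def Def62_Zx {y : C.MObj N.f𝔽} {m : ℕ} (x : Fin m → (N.tildeVprime y).V) : Set (N.NPts × N.N0Pts) :=
  {ab | N.InZx x ab.1 ab.2}

/-- **The incidence set `Inc_p(T; V♯, V₀)(𝔽)`** (Prop. 6.3, p. 28): «the subset of collections `(ξ, ξ₀, gK^{V♯,p}, g₀K₀^p, x°)` in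
`(N × N₀)(S) × (G^V(𝔸_f^p)^0/K^{V♯,p} × G^{V₀}(𝔸_f^p)^0/K₀^p) × Ṽ'(ℚ)^m` determined by the following incidence relations: (a) `h'(x°, x°) = T`.
(b) `g^{-1} ∘ x° ∘ g₀ ∈ Hom_{O_k ⊗ Ẑ^p}(T^p(E°), T^p(A°))^m`. (c) `(ξ, ξ₀) ∈ Z(x°)(S) ⊂ (N × N₀)(S)`» — (a) REAL on the ★ `HermSpace.form` of `Ṽ'`,
(b), (c) ⟨CARRIER⟩. [cite: KudlaRapoport2013, §6 Proposition 6.3 (arXiv v2 p. 28)] -/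
def IncPts (y : C.MObj N.f𝔽) (P : C.RelevantSharp) {m : ℕ} (T : Matrix (Fin m) (Fin m) (𝓞 k)) :
    Set (N.NPts × N.N0Pts × N.GModK P × N.G0ModK0 × (Fin m → (N.tildeVprime y).V)) :=
  {t | (∀ i j : Fin m, (N.tildeVprime y).form (t.2.2.2.2 i) (t.2.2.2.2 j) = ((T i j : 𝓞 k) : k)) ∧
        N.IsIntegralPair P t.2.2.1 t.2.2.2.1 t.2.2.2.2 ∧ N.InZx t.2.2.2.2 t.1 t.2.1}

/-- **[KR2013, Proposition 6.3]** (pp. 28–29): «Then `Inc_p(T; V♯, V₀)(S)` is the set of `S`-points of the formal scheme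
`Inc_p(T; V♯, V₀) = ∐_{(gK^{V♯,p}, g₀K₀^p)} ∐_{x°} Z(x°)` … Moreover, there is an isomorphism of formal stacks over `W`, compatible with the
uniformization isomorphism for `\hat M^{(V,V₀),ss}` in Corollary 5.7, `(I^V(ℚ) × I^{V₀}(ℚ))∖Inc_p(T; V♯, V₀) ≅ \hat Z^{(V♯,V₀),ss}(T)`.»
TYPED: the recorded ⟨TOKEN⟩ (5) (DELIBERATELY WEAKER than print) ∧ ON `𝔽`-POINTS for a supersingular base pair `y = (ξ°, e°)` with `ξ°` of the
`V♯`-part («compatible with Cor. 5.7»: the `M`-components are `Θ`, `Θ₀`; the homomorphisms are `x = φ^{-1} ∘ x° ∘ φ₀`, ⟨CARRIER⟩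
`xOfInc`): (1) every incidence tuple yields a point of `Z(T)(𝔽)` — `h'(x, x) = T` (p. 29: «`h'(x°, x°) = h(x, x) = T`»); (2) every point
of `Z(T)(𝔽)` lying over the `(V♯, V₀)`-part of the supersingular locus is isomorphic (READING R2: ★ `ZObj.Iso`) to the point of an incidence
tuple; (3) two incidence tuples give isomorphic points iff they are related by `I^V(ℚ) × I^{V₀}(ℚ)` on the first four components.
[cite: KudlaRapoport2013, §6 Proposition 6.3 (arXiv v2 pp. 28–29)] -/
def Prop63 : Prop :=
  N.stack.prop63 ∧
    ∀ (y : C.MObj N.f𝔽) (P : C.RelevantSharp), N.IsBasePoint y.pt P → C.IsSupersingular y.pt₀.E →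
      ∀ {m : ℕ} (T : Matrix (Fin m) (Fin m) (𝓞 k)),
        (∀ t ∈ N.IncPts y P T, ∀ i j : Fin m,
            C.hermForm (N.theta0Pts y.pt₀ t.2.1 t.2.2.2.1).ι₀ (N.thetaPts y.pt P t.1 t.2.2.1).ιA
              (N.theta0Pts y.pt₀ t.2.1 t.2.2.2.1).pol₀ (N.thetaPts y.pt P t.1 t.2.2.1).pol
              (N.xOfInc y P t.1 t.2.1 t.2.2.1 t.2.2.2.1 t.2.2.2.2 i).1 (N.xOfInc y P t.1 t.2.1 t.2.2.1 t.2.2.2.1 t.2.2.2.2 j).1 = T i j) ∧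
        (∀ z : C.ZObj N.f𝔽 T, N.InPart y z.toMObj P →
            ∃ t ∈ N.IncPts y P T, ∃ hx : ∀ i j : Fin m,
                C.hermForm (N.theta0Pts y.pt₀ t.2.1 t.2.2.2.1).ι₀ (N.thetaPts y.pt P t.1 t.2.2.1).ιA
                  (N.theta0Pts y.pt₀ t.2.1 t.2.2.2.1).pol₀ (N.thetaPts y.pt P t.1 t.2.2.1).pol
                  (N.xOfInc y P t.1 t.2.1 t.2.2.1 t.2.2.2.1 t.2.2.2.2 i).1 (N.xOfInc y P t.1 t.2.1 t.2.2.1 t.2.2.2.1 t.2.2.2.2 j).1 = T i j,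
              z.Iso ⟨⟨N.thetaPts y.pt P t.1 t.2.2.1, N.theta0Pts y.pt₀ t.2.1 t.2.2.2.1⟩,
                N.xOfInc y P t.1 t.2.1 t.2.2.1 t.2.2.2.1 t.2.2.2.2, hx⟩) ∧
        (∀ t ∈ N.IncPts y P T, ∀ t' ∈ N.IncPts y P T,
            ((N.thetaPts y.pt P t.1 t.2.2.1).toNaiveObj.Iso (N.thetaPts y.pt P t'.1 t'.2.2.1).toNaiveObj ∧
                (N.theta0Pts y.pt₀ t.2.1 t.2.2.2.1).Iso (N.theta0Pts y.pt₀ t'.2.1 t'.2.2.2.1)) ↔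
              ∃ (gm : N.IQ y.pt) (gm₀ : N.IQ0 y.pt₀), t.1 = N.actN gm t'.1 ∧ t.2.2.1 = N.actG P gm t'.2.2.1 ∧
                t.2.1 = N.actN0 gm₀ t'.2.1 ∧ t.2.2.2.1 = N.actG0 gm₀ t'.2.2.2.1)

/-- **[KR2013, Remark 6.4]** (p. 29): «When `T ∈ Herm_n(O_k)_{>0}`, so that `Z(T)` has support in the supersingular locus, there is a decomposition
`Z(T) = ∐_{(V♯,V₀)} Z(T)^{(V♯,V₀),ss}` (6.9). Suppose that `Z(T)^{(V♯,V₀),ss} ≠ ∅`. As before, let `Ṽ = Hom_k(V₀, V)` and let `Ṽ'` be the unique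
positive definite hermitian space such that `inv_ℓ(Ṽ') = inv_ℓ(Ṽ)` for all `ℓ ≠ p`. Then `Ṽ' ≅ V_T`, where `V_T = k^n` with hermitian form given by `T`.
Indeed, for any point `(A, ι, λ; E, ι₀, λ₀; x) ∈ Z(T)^{(V♯,V₀),ss}`, the last entry defines a `k`-linear map `k^n → Ṽ' = End⁰_k(E, A)` which is an
isometry.» — ON `𝔽`-POINTS (READING R6): for every point of `Z(T)(𝔽)` in the supersingular locus, the map `e_i ↦ x_i` extends to a `k`-linear
ISOMETRY `k^n ≅ Ṽ'(A, E)` for the form with Gram matrix `T`.  ((6.9) itself is the labelling by `(V♯, V₀)` of ★ `Sec2Data` and is not re-typed.)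
[cite: KudlaRapoport2013, §6 Remark 6.4 (arXiv v2 p. 29)] -/
def Rem64 : Prop :=
  ∀ (T : Matrix (Fin C.n) (Fin C.n) (𝓞 k)), IsPosDefHerm k T →
    ∀ z : C.ZObj N.f𝔽 T, C.IsSupersingular z.pt.A → C.IsSupersingular z.pt₀.E →
      ∃ e : (Fin C.n → k) ≃ₗ[k] (N.tildeVprime z.toMObj).V,
        (∀ i : Fin C.n, e (Pi.single i 1) = N.tildeVprimeEmb z.toMObj (z.x i)) ∧
          ∀ v w : Fin C.n → k,
            (N.tildeVprime z.toMObj).form (e v) (e w) = ∑ i, ∑ j, v i * ((T i j : 𝓞 k) : k) * conj ℚ k (w j)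

end Sec5Data

end Literature.AlgebraicGeometry.ShimuraVarieties.KudlaRapoport2013.Sec5Sec6SupersingularLocus

end
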